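import Literature.NumberTheory.Automorphic.LocalLanglandsGLOne
import Literature.NumberTheory.Automorphic.RankinSelbergLocalUniqueness
import Literature.NumberTheory.EllipticCurves.EisensteinNewformLevelRaisingInertiaNewvectorProofs
import Literature.NumberTheory.GaloisRepresentations.WeilDeligneRepProofs
import HarnessLib

/-!
# Twist data of a rank-2 class under two local Langlands correspondences (line
`Sketch_18745_r1_k1`, crux `DyadicOddResidue.SectorComplement`, stmt-Langlands-18745; lead's
automorphic instantiation AUT-1/AUT-2 of the rank-2 attack on generic rigidity)

Let `rec`, `rec'` be two local Langlands correspondences for the general linear groups over a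
non-archimedean local field `F`, with the SAME normalising data (`IsLocalLanglandsGL F … d 𝓔 ·`).
For an irreducible smooth GENERIC `π` of `GL₂(F)` and a quasi-character `χ` of `Fˣ`:

* `eulerFactor_pair_eq_of_isLocalLanglandsGL` — the pair Euler factors
  `eulerFactor (rec₂[π] ⊗ rec₁[χ])` and `eulerFactor (rec'₂[π] ⊗ rec'₁[χ])` coincide: both are THE
  Rankin–Selberg `L`-polynomial of `(π, χ)` (clause (iii-L) `lFactor_pairs` at `(n, m) = (2, 1)`,
  instantiated with the invariant measure on `GL₁(F) ⧸ U₁` of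
  `exists_haar_measure_quotient_fin_one` and the automatic genericity of characters of `GL₁`,
  `isGeneric_of_fin_one`; uniqueness `HasRSLFactor.unique`);
* `out_rec_one_isEquivalent_ofQuasiCharOn` — `rec₁[χ ∘ det] ≅ χ ∘ artin` on the chosen
  representative (clause (i), `IsLocalLanglandsGL.rec_one_mk`), and `isEquivalent_tprod_right`, so
  that consumers may pass to the TWIST DATA `χ ↦ eulerFactor (rec₂[π] ⊗ (χ ∘ artin))` once the
  Euler factor is known to be an isomorphism invariant (registered stub W2-A, separate file);
(The one external input of the rank-2 step — Bump 1997 §4.7 / Jacquet–Langlands 1970 Props.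
3.5–3.6: a generic NON-supercuspidal `π` of `GL₂(F)` has a quasi-character twist with non-trivial
Rankin–Selberg `L`-polynomial — enters the assembly file as an explicit hypothesis and is vendored
separately as the named fact `Bump1997_gl2_exists_twist_rsLFactor_ne_one`.)

With the Galois-side recovery (a Frobenius-semisimple 2-dimensional parameter with non-trivial
twist data is determined by its twist data) this gives `rec₂[π] = rec'₂[π]` on generic
non-supercuspidal classes — rank 2 of the registered stub
`stub_recGL_eq_of_isGeneric_of_not_isSupercuspidal`.
-/

noncomputable section

set_option linter.dupNamespace false

open scoped MatrixGroups TensorProduct Polynomial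
open Module MeasureTheory
open Literature.NumberTheory.Automorphic Literature.NumberTheory.GaloisRepresentations
open Literature.NumberTheory.EllipticCurves.Hida2000Thm326

namespace Summit.Langlands.Langlands.Theorems.ReciprocityRigidity

variable {F : Type} [Field F] [ValuativeRel F] [TopologicalSpace F] [IsNonarchimedeanLocalField F]

/-! ## Tensoring on the right with isomorphic representations -/

section TprodRight

variable {V : Type*} [AddCommGroup V] [Module ℂ V] {W : Type*} [AddCommGroup W] [Module ℂ W]
  {W' : Type*} [AddCommGroup W'] [Module ℂ W']

/-- `s ⊗ r ≅ s ⊗ r'` for `r ≅ r'` (mirror of the tree's `Equiv.tprodLeft`). [folklore] -/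
theorem isEquivalent_tprod_right (s : WeilDeligneRep F ℂ V) {r : WeilDeligneRep F ℂ W}
    {r' : WeilDeligneRep F ℂ W'} (h : r.IsEquivalent r') : (s.tprod r).IsEquivalent (s.tprod r') := by
  obtain ⟨e⟩ := h
  let erep : Representation.Equiv (s.tprod r).ρ (s.tprod r').ρ :=
    Representation.Equiv.mk (TensorProduct.congr (LinearEquiv.refl ℂ V) e.toLinearEquiv)
      (fun w => TensorProduct.ext' fun x v => by
        have h1 := e.toIntertwiningMap.isIntertwining r.ρ r'.ρ w v
        rw [Representation.Equiv.coe_toIntertwiningMap] at h1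
        simp only [LinearMap.coe_comp, Function.comp_apply, LinearEquiv.coe_coe,
          WeilDeligneRep.tprod_ρ_apply, TensorProduct.map_tmul, TensorProduct.congr_tmul,
          LinearEquiv.refl_apply]
        congr 1)
  refine ⟨{ toRepEquiv := erep, comm_N := TensorProduct.ext' fun x v => ?_ }⟩
  have h1 : e.toLinearEquiv (r.N v) = r'.N (e.toLinearEquiv v) := congr($(e.comm_N) v)
  rw [Representation.Equiv.toLinearEquiv_apply] at h1
  change TensorProduct.congr (LinearEquiv.refl ℂ V) e.toLinearEquiv ((s.tprod r).N (x ⊗ₜ v)) =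
    (s.tprod r').N (TensorProduct.congr (LinearEquiv.refl ℂ V) e.toLinearEquiv (x ⊗ₜ v))
  simp only [WeilDeligneRep.tprod_N, LinearMap.add_apply, TensorProduct.map_tmul, map_add,
    TensorProduct.congr_tmul, LinearEquiv.refl_apply, Module.End.one_apply,
    Representation.Equiv.toLinearEquiv_apply, h1]

end TprodRight

/-! ## The pair Euler factor against a character is correspondence-independent -/

section Pair

variable {hmul : @IsFrobPow.mul F _ _ _ _} {huniq : @IsFrobPow.unique F _ _ _ _}
  {hn : absInertia_normal F} {hex : @exists_isFrobPow F _ _ _ _}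
  {hns : @WeilGroup.exists_subgroup_le_inertia_isOpen_of_continuous F _ _ _ _}
  {d : LocalArtinData F} {𝓔 : LocalEpsilonSystem F}
  {rec rec' : ∀ n : ℕ, IrrClass (GL (Fin n) F) → Quotient (frobSemisimpleWDSetoid F n)}

/-- `rec₁` of the class of `χ ∘ det` is (isomorphic to) the quasi-character line `χ ∘ artin` on
`Fin 1 → ℂ` (clause (i), `IsLocalLanglandsGL.rec_one_mk`, read on the chosen representative).
[cite: HarrisTaylorAMS2001, Thm. A] -/
theorem out_rec_one_isEquivalent_ofQuasiCharOn
    (h : IsLocalLanglandsGL F hmul huniq hn hex hns d 𝓔 rec) (χ : QuasiChar F) :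
    ((rec 1 (IrrClass.mk (SmoothIrrep.ofQuasiChar χ))).out.1).IsEquivalent
      (WeilDeligneRep.ofQuasiCharOn (Fin 1 → ℂ) hns d χ) := by
  have hmk := h.rec_one_mk (π := SmoothIrrep.ofQuasiChar χ) (χ := χ)
    (SmoothIrrep.ofQuasiChar_ρ_apply χ)
  have hout := Quotient.mk_out (s := frobSemisimpleWDSetoid F 1)
    ⟨WeilDeligneRep.ofQuasiCharOn (Fin 1 → ℂ) hns d χ,
      WeilDeligneRep.isFrobSemisimple_ofQuasiCharOn hns d χ⟩
  rw [← hmk] at hout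
  exact hout

/-- **The pair Euler factor of `(π, χ)` does not depend on the correspondence.**  For two local
Langlands correspondences `rec`, `rec'` (same normalising data), a generic irreducible smooth `π`
of `GL₂(F)` and an irreducible `π'` of `GL₁(F)`:
`eulerFactor (rec₂[π] ⊗ rec₁[π']) = eulerFactor (rec'₂[π] ⊗ rec'₁[π'])` — both are the
Rankin–Selberg `L`-polynomial of the pair (clause (iii-L) at `(2, 1)` for the invariant measure on
`GL₁(F) ⧸ U₁`; characters of `GL₁` are generic; `HasRSLFactor.unique`).
[cite: JacquetPiatetskiShapiroShalika1983, Thm 2.7] [cite: HarrisTaylorAMS2001, Thm. A] -/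
theorem eulerFactor_pair_eq_of_isLocalLanglandsGL
    (h : IsLocalLanglandsGL F hmul huniq hn hex hns d 𝓔 rec)
    (h' : IsLocalLanglandsGL F hmul huniq hn hex hns d 𝓔 rec')
    (π : SmoothIrrep (GL (Fin 2) F)) {ψ : AddChar F Circle} (hψ : ψ.IsContinuousNontrivial)
    (hg : IsGeneric π.ρ ψ) (π' : SmoothIrrep (GL (Fin 1) F)) :
    (((rec 2 (IrrClass.mk π)).out.1).tprod ((rec 1 (IrrClass.mk π')).out.1)).eulerFactor hn hex =
      (((rec' 2 (IrrClass.mk π)).out.1).tprod ((rec' 1 (IrrClass.mk π')).out.1)).eulerFactor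
        hn hex := by
  letI : MeasurableSpace F := borel F
  haveI : BorelSpace F := ⟨rfl⟩
  letI : MeasurableSpace (GL (Fin 1) F ⧸ upperUnitriangular (Fin 1) F) := borel _
  haveI : BorelSpace (GL (Fin 1) F ⧸ upperUnitriangular (Fin 1) F) := ⟨rfl⟩
  obtain ⟨_, _, ν, hinv, hfin, hpos, -⟩ := exists_haar_measure_quotient_fin_one (F := F)
  haveI := hinv
  haveI := hfin
  haveI := hpos
  haveI : Nontrivial π'.V := Module.nontrivial_of_finrank_eq_succ π'.finrank_eq_one_glOne
  have hg' : IsGeneric π'.ρ ψ⁻¹ := isGeneric_of_fin_one _ _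
  have h1 := (h.lFactor_pairs Nat.one_pos Nat.one_lt_two π π' ψ hψ hg hg' ν _).2 rfl
  have h2 := (h'.lFactor_pairs Nat.one_pos Nat.one_lt_two π π' ψ hψ hg hg' ν _).2 rfl
  exact h1.unique h2

end Pair





end Summit.Langlands.Langlands.Theorems.ReciprocityRigidity

end
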